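import Summits.QuantumFields.BalabanUV.Gaps.EndDrawdownLinearThresholdFlow
import Summits.QuantumFields.BalabanUV.Gaps.EndDrawdownLinearThresholdCritical

/-!
# Gaps / EndDrawdownLinearThresholdUpper — THE OTHER HALF: `C⋆(bOct) ≤ √(84∕(77 + 72·log 2))`, HENCE `C⋆(bOct) = cStarConj = 0.81357…`

X18 (`EndDrawdownLinearThresholdLower`) proved `cStarConj ≤ C⋆(bOct)` by feeding GEN 11's NECESSITY criterion a monotone Euler-vs-flow-time comparison.
THIS FILE proves the UPPER half by feeding GEN 11's SUFFICIENCY criterion `EndDrawdownLinearThresholdRenormSuff.endPossibleLin_bOct_of_escape`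
(`τ_m ≤ 2C²` and some iterate `ν_{n₀} > 7∕3` of the `8^m`-piece BACKWARD Euler block map from the tail floor `C²` ⟹ possible) the same kind of
comparison, now against X17's flow `Phi`:
* X18's comparisons (`flowTime_sub_ge` ∕ `flowTime_sub_le`: `(b² − a²)·b∕(b−C) ≤ T(b) − T(a) ≤ (b² − a²)·a∕(a − C)`) and its backward-piece bounds
  (`sq_lt_rStep`, `flowTime_rStep_bounds`: one BACKWARD Euler piece `rStep C h x = x − h(1 − C∕√x)` from `x > C²` costs flow time in `[h, 2C²h∕(2C² − h)]`
  — the descending speed only decreases, and cannot collapse faster than the approach to the equilibrium `C²` allows) give: the `8^m` pieces of GEN 11's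
  block map `Bm` cost flow time in `[7, 7 + 7h∕(2C² − h)]`
  (**`flowTime_Bm_bounds`**), whence **`Bm_exact_bounds`**: `0 ≤ Φ₇(4κ) − Bm_m(κ) ≤ 7h∕(2C² − h)` UNIFORMLY in `κ ≥ C²`;
* the flow is ORDER-PRESERVING and `1`-LIPSCHITZ (**`Phi_mono`**, **`Phi_sub_le`**: the drop `w − Φ_τ(w)` is non-decreasing in `w`, because the time
  coordinate `G(w) = T(√w)` has DECREASING derivative `√w∕(√w − C)` — **`hasDerivAt_timeCoord`**), so the exact block map `κ ↦ Φ₇(4κ)` is monotone and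
  `4`-Lipschitz and the Euler iterates track the exact ones: **`nu_track`**: `ν_n ≤ e_n ≤ ν_n + δ·(4^n − 1)∕3`;
* ABOVE the constant the exact block map climbs with a uniform gap (**`exact_gap`**: `Φ₇(4κ) − κ ≥ η·(√κ₁ − C)∕√κ₁` on `κ ≥ κ₁ > C²`, `η = C²ψ(7∕3) − 7 > 0`
  — the halving time from `2√κ` is `C²ψ(2√κ∕C) ≥ C²ψ(7∕3) > 7`), so the exact iterates from `C²` ESCAPE past `7∕3 + 1` (**`exact_escape`**), and for `8^m`
  large the Euler iterates pass `7∕3` (**`exists_escape_of_gt_cStarConj`**): the criterion fires —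
  **`endPossibleLin_bOct_of_gt_cStarConj`: for every `C > cStarConj` and every box, `EndPossibleLin bOct C γ₀`.**
TOGETHER WITH X18: **`threshold_bOct_eq_cStarConj`** — for `0 < C < cStarConj` impossible, for `C > cStarConj` possible: GEN 11's CONJECTURE
`C⋆(bOct) = √(84∕(77 + 72·log 2))` IS A KERNEL THEOREM; and with X20 (`EndDrawdownLinearThresholdCritical.not_endPossibleLin_bOct_of_le_cStarConj`,
the critical value itself is impossible) the full trichotomy **`endPossibleLin_bOct_iff`: for `0 < C`, `γ₀ > 0`, `EndPossibleLin bOct C γ₀ ↔ cStarConj < C`**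
— the possible constants form exactly the OPEN half-line above `cStarConj`.

(cell pub-balaban-gaps, seat g1-p3 GEN 12, rows CAP ∕ tail «split ∕ weakening»; own leaf; file 36 of «the one-loop interface of the END statement»; imports
X17 (hence X18, X16, X15) and X20; proof lane, no new definitions.)

HONEST FRAMING (cell rule, page 1 of everything): [folklore] one-variable calculus (monotone comparisons between explicit Euler schemes and the time
function of one scalar ODE) fed to the seat's kernel-checked sufficiency criterion for ONE toy sequence; `EndPossibleLin` is a quantified READING of
the cell's END-grade statement over Bałaban-free data `(b, C, γ₀)`; the theorem locates the threshold constant of a TOY — 0 binders of Bałaban's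
discharged; 0 coefficients certified; words ∕ odds of rows CAP ∕ tail ∕ (D4) ∕ (D1) UNCHANGED; one finite T⁴; NOT [I] Thm 2, NOT `BetaPertH`, NOT the
continuum limit, NOT Clay.
-/

namespace Summit.QuantumFields.BalabanUV.Gaps.EndDrawdownLinearThresholdUpper

open Real Set
open Summit.QuantumFields.BalabanUV.Gaps.EndDrawdownLinearRoad (EndPossibleLin)
open Summit.QuantumFields.BalabanUV.Gaps.EndDrawdownCooperatorExtremal (endPossibleLin_mono)
open Summit.QuantumFields.BalabanUV.Gaps.EndDrawdownLinearThreshold (bOct)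
open Summit.QuantumFields.BalabanUV.Gaps.EndDrawdownLinearThresholdRenormPieces (tauS Bm nu tauS_pos sq_le_nu)
open Summit.QuantumFields.BalabanUV.Gaps.EndDrawdownLinearThresholdRenormSuff (endPossibleLin_bOct_of_escape)
open Summit.QuantumFields.BalabanUV.Gaps.EndDrawdownLinearThresholdConstant
open Summit.QuantumFields.BalabanUV.Gaps.EndDrawdownLinearThresholdLower (flowTime_strictMonoOn flowTime_injOn flowTime_sub_ge
  flowTime_sub_le sq_lt_rStep flowTime_rStep_bounds flowTime_iterate_rStep not_endPossibleLin_bOct_of_lt_cStarConj)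
open Summit.QuantumFields.BalabanUV.Gaps.EndDrawdownLinearThresholdFlow
open Summit.QuantumFields.BalabanUV.Gaps.EndDrawdownLinearThresholdCritical (not_endPossibleLin_bOct_of_le_cStarConj)

noncomputable section

/-! ## §1 The backward Euler block against the flow -/

/-- THE BLOCK: for `κ ≥ C²` and `h = τ_m < 2C²`, GEN 11's backward block `Bm_m(κ) = rStep^{[8^m]}(4κ)` stays above the floor and costs flow time
in `[7, 7·2C²∕(2C² − τ_m)]`. [folklore] -/
theorem flowTime_Bm_bounds {C κ : ℝ} (hC : 0 < C) {m : ℕ} (hm : tauS m < 2 * C ^ 2) (hκ : C ^ 2 ≤ κ) :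
    C ^ 2 < Bm m C κ ∧ 7 ≤ flowTime C (Real.sqrt (4 * κ)) - flowTime C (Real.sqrt (Bm m C κ)) ∧
      flowTime C (Real.sqrt (4 * κ)) - flowTime C (Real.sqrt (Bm m C κ)) ≤ 7 * (2 * C ^ 2 / (2 * C ^ 2 - tauS m)) := by
  have h4 : C ^ 2 < 4 * κ := by nlinarith [sq_nonneg C, hC]
  obtain ⟨h1, h2, h3⟩ := flowTime_iterate_rStep hC (tauS_pos m).le hm h4 (8 ^ m)
  have hN : ((8 ^ m : ℕ) : ℝ) * tauS m = 7 := by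
    rw [Nat.cast_pow, Nat.cast_ofNat]; unfold tauS; field_simp
  refine ⟨h1, by rw [← hN]; exact h2, ?_⟩
  calc flowTime C (Real.sqrt (4 * κ)) - flowTime C (Real.sqrt (Bm m C κ))
      ≤ ((8 ^ m : ℕ) : ℝ) * (2 * C ^ 2 * tauS m / (2 * C ^ 2 - tauS m)) := h3
    _ = 7 * (2 * C ^ 2 / (2 * C ^ 2 - tauS m)) := by
        rw [← hN]; ring

/-! ## §2 Euler below the flow, by at most `7τ∕(2C² − τ)` per block -/

/-- EULER BELOW THE FLOW, UNIFORMLY CLOSE: `Bm_m(κ) ≤ Φ₇(4κ) ≤ Bm_m(κ) + 7τ_m∕(2C² − τ_m)` for every `κ ≥ C²` — the Euler block costs flow time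
in `[7, 7 + 7τ∕(2C² − τ)]`, and a time difference bounds a height difference from above (`T(b) − T(a) ≥ b² − a²`). [folklore] -/
theorem Bm_exact_bounds {C κ : ℝ} (hC : 0 < C) {m : ℕ} (hm : tauS m < 2 * C ^ 2) (hκ : C ^ 2 ≤ κ) :
    Bm m C κ ≤ Phi C 7 (4 * κ) ∧ Phi C 7 (4 * κ) - Bm m C κ ≤ 7 * tauS m / (2 * C ^ 2 - tauS m) := by
  obtain ⟨h1, h2, h3⟩ := flowTime_Bm_bounds hC hm hκ
  obtain ⟨hv, hT⟩ := vFlow_spec hC 7 (Real.sqrt (4 * κ))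
  set a := Real.sqrt (Bm m C κ) with ha
  set b := vFlow C 7 (Real.sqrt (4 * κ)) with hb
  have haC : C < a := (Real.lt_sqrt hC.le).mpr h1
  have hab : a ≤ b := by
    have hle : flowTime C a ≤ flowTime C b := by rw [hT]; linarith
    exact ((flowTime_strictMonoOn hC).le_iff_le haC hv).mp hle
  have hcmp := flowTime_sub_ge hC haC hab
  have hk : 1 ≤ b / (b - C) := by rw [le_div_iff₀ (by linarith)]; linarith
  have hsq : b ^ 2 - a ^ 2 ≤ (b ^ 2 - a ^ 2) * (b / (b - C)) := le_mul_of_one_le_right (by nlinarith) hk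
  have htime : flowTime C b - flowTime C a ≤ 7 * tauS m / (2 * C ^ 2 - tauS m) := by
    have hpos : 0 < 2 * C ^ 2 - tauS m := by linarith
    rw [hT]
    have e : 7 * (2 * C ^ 2 / (2 * C ^ 2 - tauS m)) = 7 + 7 * tauS m / (2 * C ^ 2 - tauS m) := by
      field_simp; ring
    linarith [h3, e]
  have hPhi : Phi C 7 (4 * κ) = b ^ 2 := rfl
  have hBm : Bm m C κ = a ^ 2 := (Real.sq_sqrt (lt_trans (by positivity) h1).le).symm
  rw [hPhi, hBm]
  exact ⟨by nlinarith [hab, lt_trans hC haC], by linarith⟩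

/-! ## §3 The flow is order-preserving and `1`-Lipschitz -/

/-- ORDER: `C² < w₁ ≤ w₂ ⟹ Φ_τ(w₁) ≤ Φ_τ(w₂)`. [folklore] -/
theorem Phi_mono {C τ w₁ w₂ : ℝ} (hC : 0 < C) (hw₁ : C ^ 2 < w₁) (hw : w₁ ≤ w₂) : Phi C τ w₁ ≤ Phi C τ w₂ := by
  obtain ⟨hv₁, hT₁⟩ := vFlow_spec hC τ (Real.sqrt w₁)
  obtain ⟨hv₂, hT₂⟩ := vFlow_spec hC τ (Real.sqrt w₂)
  have hs₁ : C < Real.sqrt w₁ := (Real.lt_sqrt hC.le).mpr hw₁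
  have hs₂ : C < Real.sqrt w₂ := (Real.lt_sqrt hC.le).mpr (lt_of_lt_of_le hw₁ hw)
  have hss : Real.sqrt w₁ ≤ Real.sqrt w₂ := Real.sqrt_le_sqrt hw
  have hTle : flowTime C (Real.sqrt w₁) ≤ flowTime C (Real.sqrt w₂) := ((flowTime_strictMonoOn hC).le_iff_le hs₁ hs₂).mpr hss
  have hle : flowTime C (vFlow C τ (Real.sqrt w₁)) ≤ flowTime C (vFlow C τ (Real.sqrt w₂)) := by rw [hT₁, hT₂]; linarith
  have := ((flowTime_strictMonoOn hC).le_iff_le hv₁ hv₂).mp hle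
  unfold Phi
  gcongr
  exact (lt_trans hC hv₁).le

/-- The TIME COORDINATE `G(w) = T_C(√w)` on `w > C²` has derivative `√w∕(√w − C)` (chain rule). [folklore] -/
theorem hasDerivAt_timeCoord {C w : ℝ} (hC : 0 < C) (hw : C ^ 2 < w) :
    HasDerivAt (fun w : ℝ => flowTime C (Real.sqrt w)) (Real.sqrt w / (Real.sqrt w - C)) w := by
  have hw0 : 0 < w := lt_trans (by positivity) hw
  have hs : C < Real.sqrt w := (Real.lt_sqrt hC.le).mpr hw
  have hs0 : Real.sqrt w ≠ 0 := (Real.sqrt_pos.mpr hw0).ne'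
  have hsC : Real.sqrt w - C ≠ 0 := (sub_pos.mpr hs).ne'
  have h := (hasDerivAt_flowTime hs).comp w (Real.hasDerivAt_sqrt hw0.ne')
  refine h.congr_deriv ?_
  rw [Real.sq_sqrt hw0.le]
  field_simp
  rw [Real.sq_sqrt hw0.le]

/-- The derivative of the time coordinate DECREASES: `√w₂∕(√w₂ − C) ≤ √w₁∕(√w₁ − C)` for `C² < w₁ ≤ w₂`. [folklore] -/
theorem timeCoord_deriv_anti {C w₁ w₂ : ℝ} (hC : 0 < C) (hw₁ : C ^ 2 < w₁) (hw : w₁ ≤ w₂) :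
    Real.sqrt w₂ / (Real.sqrt w₂ - C) ≤ Real.sqrt w₁ / (Real.sqrt w₁ - C) := by
  have hs₁ : C < Real.sqrt w₁ := (Real.lt_sqrt hC.le).mpr hw₁
  have hs₂ : C < Real.sqrt w₂ := (Real.lt_sqrt hC.le).mpr (lt_of_lt_of_le hw₁ hw)
  have hss : Real.sqrt w₁ ≤ Real.sqrt w₂ := Real.sqrt_le_sqrt hw
  rw [div_le_div_iff₀ (by linarith) (by linarith)]
  nlinarith

/-- `1`-LIPSCHITZ (the DROP `w − Φ_τ(w)` is non-decreasing in `w`): `C² < w₁ ≤ w₂`, `0 ≤ τ ⟹ Φ_τ(w₂) − Φ_τ(w₁) ≤ w₂ − w₁`.  If the higher start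
dropped less, `w ↦ G(w) − G(w − D₂)` (antitone, `G′` decreasing) would take the value `τ` at `w₂` but a value `< τ` at `w₁`. [folklore] -/
theorem Phi_sub_le {C τ w₁ w₂ : ℝ} (hC : 0 < C) (hτ : 0 ≤ τ) (hw₁ : C ^ 2 < w₁) (hw : w₁ ≤ w₂) :
    Phi C τ w₂ - Phi C τ w₁ ≤ w₂ - w₁ := by
  have hw₂ : C ^ 2 < w₂ := lt_of_lt_of_le hw₁ hw
  obtain ⟨hv₁, hT₁⟩ := vFlow_spec hC τ (Real.sqrt w₁)
  obtain ⟨hv₂, hT₂⟩ := vFlow_spec hC τ (Real.sqrt w₂)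
  -- Φ-values and drops
  set u₁ := Phi C τ w₁ with hu₁
  set u₂ := Phi C τ w₂ with hu₂
  have hu₁C : C ^ 2 < u₁ := sq_lt_Phi hC τ w₁
  have hu₂C : C ^ 2 < u₂ := sq_lt_Phi hC τ w₂
  have hsu₁ : Real.sqrt u₁ = vFlow C τ (Real.sqrt w₁) := sqrt_Phi hC τ w₁
  have hsu₂ : Real.sqrt u₂ = vFlow C τ (Real.sqrt w₂) := sqrt_Phi hC τ w₂
  -- G(w_i) − G(u_i) = τ
  have hG₁ : flowTime C (Real.sqrt w₁) - flowTime C (Real.sqrt u₁) = τ := by rw [hsu₁, hT₁]; ring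
  have hG₂ : flowTime C (Real.sqrt w₂) - flowTime C (Real.sqrt u₂) = τ := by rw [hsu₂, hT₂]; ring
  -- drops are ≥ 0: u_i ≤ w_i (τ ≥ 0)
  have hmonoT : ∀ {p q : ℝ}, C ^ 2 < p → C ^ 2 < q → (flowTime C (Real.sqrt p) ≤ flowTime C (Real.sqrt q) ↔ p ≤ q) := by
    intro p q hp hq
    have hp' : C < Real.sqrt p := (Real.lt_sqrt hC.le).mpr hp
    have hq' : C < Real.sqrt q := (Real.lt_sqrt hC.le).mpr hq
    rw [(flowTime_strictMonoOn hC).le_iff_le hp' hq']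
    exact Real.sqrt_le_sqrt_iff (lt_trans (by positivity) hq).le
  by_contra hcon
  push Not at hcon
  -- D₂ < D₁
  set D₂ := w₂ - u₂ with hD₂
  have hD₂0 : 0 ≤ D₂ := by have := (hmonoT hu₂C hw₂).mp (by linarith); linarith
  have hlt : u₁ < w₁ - D₂ := by rw [hD₂]; linarith
  -- φ(w) = G(w) − G(w − D₂) is antitone on [w₁, w₂]
  have hdom : ∀ w ∈ Icc w₁ w₂, C ^ 2 < w - D₂ := fun w hw' => lt_trans hu₁C (lt_of_lt_of_le hlt (by linarith [hw'.1]))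
  have hD : ∀ w ∈ Icc w₁ w₂, HasDerivAt (fun w : ℝ => flowTime C (Real.sqrt w) - flowTime C (Real.sqrt (w - D₂)))
      (Real.sqrt w / (Real.sqrt w - C) - Real.sqrt (w - D₂) / (Real.sqrt (w - D₂) - C)) w := by
    intro w hw'
    have h1 := hasDerivAt_timeCoord hC (lt_of_lt_of_le hw₁ hw'.1)
    have h2 := (hasDerivAt_timeCoord hC (hdom w hw')).comp w ((hasDerivAt_id w).sub_const D₂)
    simp only [mul_one] at h2
    exact h1.sub h2
  have hanti : AntitoneOn (fun w : ℝ => flowTime C (Real.sqrt w) - flowTime C (Real.sqrt (w - D₂))) (Icc w₁ w₂) := by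
    refine antitoneOn_of_hasDerivWithinAt_nonpos (convex_Icc _ _) (fun w hw' => (hD w hw').continuousAt.continuousWithinAt)
      (fun w hw' => (hD w (interior_subset hw')).hasDerivWithinAt) fun w hw' => ?_
    have hw' := interior_subset hw'
    have := timeCoord_deriv_anti hC (hdom w hw') (by linarith : w - D₂ ≤ w)
    linarith
  have hφ := hanti ⟨le_rfl, hw⟩ ⟨hw, le_rfl⟩ hw
  simp only at hφ
  -- φ(w₂) = τ, φ(w₁) < τ
  have hφ₂ : flowTime C (Real.sqrt w₂) - flowTime C (Real.sqrt (w₂ - D₂)) = τ := by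
    rw [hD₂, sub_sub_cancel]; exact hG₂
  have hφ₁ : flowTime C (Real.sqrt w₁) - flowTime C (Real.sqrt (w₁ - D₂)) < τ := by
    have hstrict : flowTime C (Real.sqrt u₁) < flowTime C (Real.sqrt (w₁ - D₂)) := by
      have h1 : C < Real.sqrt u₁ := (Real.lt_sqrt hC.le).mpr hu₁C
      have h2 : C < Real.sqrt (w₁ - D₂) := (Real.lt_sqrt hC.le).mpr (hdom w₁ ⟨le_rfl, hw⟩)
      exact ((flowTime_strictMonoOn hC).lt_iff_lt h1 h2).mpr
        (Real.sqrt_lt_sqrt (lt_trans (by positivity) hu₁C).le hlt)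
    linarith
  linarith

/-! ## §4 Tracking: the Euler iterates `ν_n` stay within `δ(4^n − 1)∕3` of the exact iterates -/

/-- THE TRACKING ESTIMATE: with `e_n := (κ ↦ Φ₇(4κ))^{[n]}(C²)` the exact backward iterates and `δ = 7τ_m∕(2C² − τ_m)` (`τ_m < 2C²`),
`ν_n ≤ e_n ≤ ν_n + δ·(4^n − 1)∕3` for every `n`. [folklore] -/
theorem nu_track {C : ℝ} (hC : 0 < C) {m : ℕ} (hm : tauS m < 2 * C ^ 2) (n : ℕ) :
    nu m C n ≤ (fun κ => Phi C 7 (4 * κ))^[n] (C ^ 2) ∧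
      (fun κ => Phi C 7 (4 * κ))^[n] (C ^ 2) - nu m C n ≤ 7 * tauS m / (2 * C ^ 2 - tauS m) * (4 ^ n - 1) / 3 := by
  induction n with
  | zero => simp [nu]
  | succ n ih =>
    obtain ⟨hle, herr⟩ := ih
    set e := (fun κ => Phi C 7 (4 * κ))^[n] (C ^ 2) with he
    have hν : C ^ 2 ≤ nu m C n := sq_le_nu hC m hm.le n
    rw [Function.iterate_succ_apply', ← he, show nu m C (n + 1) = Bm m C (nu m C n) from rfl]
    obtain ⟨h1, h2⟩ := Bm_exact_bounds hC hm hν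
    have h4ν : C ^ 2 < 4 * nu m C n := by nlinarith [sq_nonneg C, hC]
    have h3 : Phi C 7 (4 * nu m C n) ≤ Phi C 7 (4 * e) := Phi_mono hC h4ν (by linarith)
    have h4 : Phi C 7 (4 * e) - Phi C 7 (4 * nu m C n) ≤ 4 * e - 4 * nu m C n := Phi_sub_le hC (by norm_num) h4ν (by linarith)
    refine ⟨le_trans h1 h3, ?_⟩
    have hδ : 0 ≤ 7 * tauS m / (2 * C ^ 2 - tauS m) := div_nonneg (by linarith [(tauS_pos m).le]) (by linarith)
    rw [show (4 : ℝ) ^ (n + 1) = 4 ^ n * 4 from pow_succ 4 n]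
    nlinarith

/-! ## §5 Above the constant the exact iterates escape -/

/-- UNIFORM GAP above the constant: if `η := C²ψ(7∕3) − 7 > 0` (i.e. `C > cStarConj`) and `C² < κ₁ ≤ κ`, then
`Φ₇(4κ) − κ ≥ η·(√κ₁ − C)∕√κ₁ > 0` — the flow needs time `C²ψ(2√κ∕C) ≥ C²ψ(7∕3) = 7 + η` to halve `2√κ`, so after time `7` it is still above
`κ` by a time margin `η`, converted to height by `flowTime_sub_le`. [folklore] -/
theorem exact_gap {C κ₁ κ : ℝ} (hC : 0 < C) (hη : 0 < C ^ 2 * psi (7 / 3) - 7) (hκ₁ : C ^ 2 < κ₁) (hκ : κ₁ ≤ κ) :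
    (C ^ 2 * psi (7 / 3) - 7) * ((Real.sqrt κ₁ - C) / Real.sqrt κ₁) ≤ Phi C 7 (4 * κ) - κ := by
  have hκC : C ^ 2 < κ := lt_of_lt_of_le hκ₁ hκ
  have hκ0 : 0 < κ := lt_trans (by positivity) hκC
  have hs : C < Real.sqrt κ := (Real.lt_sqrt hC.le).mpr hκC
  have hs₁ : C < Real.sqrt κ₁ := (Real.lt_sqrt hC.le).mpr hκ₁
  have hs4 : Real.sqrt (4 * κ) = 2 * Real.sqrt κ := by
    rw [Real.sqrt_mul (by norm_num), show Real.sqrt 4 = 2 by rw [show (4:ℝ) = 2 ^ 2 by norm_num, Real.sqrt_sq (by norm_num)]]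
  obtain ⟨hv, hT⟩ := vFlow_spec hC 7 (Real.sqrt (4 * κ))
  set b := vFlow C 7 (Real.sqrt (4 * κ)) with hb
  -- halving time from 2√κ
  have hhalf : flowTime C (2 * Real.sqrt κ) - flowTime C (Real.sqrt κ) = C ^ 2 * psi (2 * Real.sqrt κ / C) := by
    have h := flowTime_sub_half hC (show 2 * C < 2 * Real.sqrt κ by linarith)
    rwa [show 2 * Real.sqrt κ / 2 = Real.sqrt κ by ring] at h
  have hpsi : psi (7 / 3) ≤ psi (2 * Real.sqrt κ / C) := psi_min_le (by rw [lt_div_iff₀ hC]; linarith)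
  -- time margin η ≤ T(b) − T(√κ)
  have hmargin : C ^ 2 * psi (7 / 3) - 7 ≤ flowTime C b - flowTime C (Real.sqrt κ) := by
    rw [hT, hs4]; nlinarith [hhalf, hpsi, sq_nonneg C]
  have hab : Real.sqrt κ ≤ b := by
    have : flowTime C (Real.sqrt κ) ≤ flowTime C b := by linarith
    exact ((flowTime_strictMonoOn hC).le_iff_le hs hv).mp this
  have h1 := flowTime_sub_le hC hs hab
  have hk1 : 0 < Real.sqrt κ / (Real.sqrt κ - C) := div_pos (by linarith) (by linarith)
  have hPhi : Phi C 7 (4 * κ) = b ^ 2 := rfl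
  have hκs : Real.sqrt κ ^ 2 = κ := Real.sq_sqrt hκ0.le
  have hstep : (C ^ 2 * psi (7 / 3) - 7) * ((Real.sqrt κ - C) / Real.sqrt κ) ≤ b ^ 2 - κ := by
    have hkinv : (Real.sqrt κ - C) / Real.sqrt κ = (Real.sqrt κ / (Real.sqrt κ - C))⁻¹ := by rw [inv_div]
    rw [hkinv, ← div_eq_mul_inv, div_le_iff₀ hk1]
    rw [hκs] at h1
    linarith
  have hfrac_le : (Real.sqrt κ₁ - C) / Real.sqrt κ₁ ≤ (Real.sqrt κ - C) / Real.sqrt κ := by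
    rw [div_le_div_iff₀ (by linarith) (by linarith)]
    nlinarith [Real.sqrt_le_sqrt hκ, hC]
  rw [hPhi]
  nlinarith [hstep, hfrac_le, hη]

/-- ESCAPE: for `C > cStarConj` the exact backward iterates from the tail floor exceed `7∕3 + 1` at some `n₀`. [folklore] -/
theorem exact_escape {C : ℝ} (hC : 0 < C) (hlt : cStarConj < C) :
    ∃ n₀ : ℕ, 7 / 3 + 1 < (fun κ => Phi C 7 (4 * κ))^[n₀] (C ^ 2) := by
  set E : ℝ → ℝ := fun κ => Phi C 7 (4 * κ) with hE
  set κ₁ := E (C ^ 2) with hκ₁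
  have hκ₁C : C ^ 2 < κ₁ := sq_lt_Phi hC 7 _
  have hη : 0 < C ^ 2 * psi (7 / 3) - 7 := by
    have h1 : cStarConj ^ 2 < C ^ 2 := by gcongr; exact cStarConj_pos.le
    nlinarith [cStarConj_sq_mul_psiMin, psi_seven_thirds_gt_ten]
  set η' := (C ^ 2 * psi (7 / 3) - 7) * ((Real.sqrt κ₁ - C) / Real.sqrt κ₁) with hη'
  have hs₁ : C < Real.sqrt κ₁ := (Real.lt_sqrt hC.le).mpr hκ₁C
  have hη'0 : 0 < η' := mul_pos hη (div_pos (by linarith) (by linarith))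
  -- e_{n+1} ≥ κ₁ + n·η'
  have hgrow : ∀ n : ℕ, κ₁ + n * η' ≤ E^[n + 1] (C ^ 2) := by
    intro n
    induction n with
    | zero => simp [hκ₁]
    | succ n ih =>
      rw [Function.iterate_succ_apply', Nat.cast_succ]
      have hge : κ₁ ≤ E^[n + 1] (C ^ 2) := le_trans (by nlinarith) ih
      have := exact_gap hC hη hκ₁C hge
      simp only [hE] at this ⊢
      linarith
  obtain ⟨n, hn⟩ := exists_nat_gt ((7 / 3 + 1 - κ₁) / η')
  refine ⟨n + 1, lt_of_lt_of_le ?_ (hgrow n)⟩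
  rw [div_lt_iff₀ hη'0] at hn
  linarith

/-- THE ESCAPE HYPOTHESIS of GEN 11's sufficiency criterion holds above the constant: some `m` with `τ_m ≤ 2C²` and some `n₀` with `ν_{n₀} > 7∕3`.
[folklore] -/
theorem exists_escape_of_gt_cStarConj {C : ℝ} (hC : 0 < C) (hlt : cStarConj < C) :
    ∃ m n₀ : ℕ, tauS m ≤ 2 * C ^ 2 ∧ 7 / 3 < nu m C n₀ := by
  obtain ⟨n₀, hn₀⟩ := exact_escape hC hlt
  -- choose `m` with `τ_m ≤ C²` and `(7τ_m∕C²)(4^{n₀} − 1)∕3 < 1`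
  obtain ⟨m, hm⟩ := pow_unbounded_of_one_lt (7 / C ^ 2 + 49 * 4 ^ n₀ / C ^ 2) (by norm_num : (1 : ℝ) < 8)
  have hC2 : 0 < C ^ 2 := by positivity
  have h8 : (0 : ℝ) < 8 ^ m := by positivity
  have hτ : tauS m = 7 / 8 ^ m := rfl
  have h49 : 0 ≤ 49 * 4 ^ n₀ / C ^ 2 := by positivity
  have h7 : 0 ≤ 7 / C ^ 2 := by positivity
  have hτC : tauS m ≤ C ^ 2 := by
    rw [hτ, div_le_iff₀ h8]
    have : 7 / C ^ 2 < 8 ^ m := by linarith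
    rw [div_lt_iff₀ hC2] at this
    linarith
  have hm2 : tauS m < 2 * C ^ 2 := by linarith
  refine ⟨m, n₀, by linarith, ?_⟩
  obtain ⟨-, herr⟩ := nu_track hC hm2 n₀
  -- δ(4^{n₀} − 1)∕3 ≤ (7τ∕C²)·4^{n₀} < 1
  have hδ : 7 * tauS m / (2 * C ^ 2 - tauS m) ≤ 7 * tauS m / C ^ 2 :=
    div_le_div_of_nonneg_left (by linarith [(tauS_pos m).le]) hC2 (by linarith)
  have hsmall : 7 * tauS m / C ^ 2 * (4 ^ n₀ - 1) / 3 < 1 := by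
    have h1 : 7 * tauS m / C ^ 2 * 4 ^ n₀ < 1 := by
      rw [hτ]
      have : 49 * 4 ^ n₀ / C ^ 2 < 8 ^ m := by linarith
      rw [div_lt_iff₀ hC2] at this
      rw [show 7 * (7 / 8 ^ m) / C ^ 2 * 4 ^ n₀ = 49 * 4 ^ n₀ / (8 ^ m * C ^ 2) by field_simp; ring,
        div_lt_one (by positivity)]
      linarith
    have h0 : 0 ≤ 7 * tauS m / C ^ 2 := div_nonneg (by linarith [(tauS_pos m).le]) hC2.le
    nlinarith [pow_pos (by norm_num : (0:ℝ) < 4) n₀]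
  have h4 : (0 : ℝ) ≤ 4 ^ n₀ - 1 := by linarith [one_le_pow₀ (by norm_num : (1 : ℝ) ≤ 4) (n := n₀)]
  have herr' : (fun κ => Phi C 7 (4 * κ))^[n₀] (C ^ 2) - nu m C n₀ < 1 := by
    calc (fun κ => Phi C 7 (4 * κ))^[n₀] (C ^ 2) - nu m C n₀
        ≤ 7 * tauS m / (2 * C ^ 2 - tauS m) * (4 ^ n₀ - 1) / 3 := herr
      _ ≤ 7 * tauS m / C ^ 2 * (4 ^ n₀ - 1) / 3 := by gcongr
      _ < 1 := hsmall
  linarith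

/-! ## §6 The headline: the conjecture is a theorem -/

/-- **THE OTHER HALF: above `cStarConj = √(84∕(77 + 72·log 2))` the octal staircase is POSSIBLE on every box.** [folklore] -/
theorem endPossibleLin_bOct_of_gt_cStarConj {C γ₀ : ℝ} (hlt : cStarConj < C) (hγ₀ : 0 < γ₀) : EndPossibleLin bOct C γ₀ := by
  have hC : 0 < C := lt_trans cStarConj_pos hlt
  obtain ⟨m, n₀, hτ, hν⟩ := exists_escape_of_gt_cStarConj hC hlt
  exact endPossibleLin_bOct_of_escape hC hτ hν hγ₀

/-- **GEN 11's CONJECTURE IS A THEOREM: the threshold of the octal staircase on the linear road is EXACTLY `cStarConj = √(84∕(77 + 72·log 2)) =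
0.81357…`** — impossible for every `0 < C < cStarConj` (X18), possible for every `C > cStarConj` (this file), on every box `γ₀ > 0` (the critical
value: `endPossibleLin_bOct_iff` below). [folklore] -/
theorem threshold_bOct_eq_cStarConj {γ₀ : ℝ} (hγ₀ : 0 < γ₀) :
    (∀ C, cStarConj < C → EndPossibleLin bOct C γ₀) ∧ ∀ C, 0 < C → C < cStarConj → ¬ EndPossibleLin bOct C γ₀ :=
  ⟨fun _ hC => endPossibleLin_bOct_of_gt_cStarConj hC hγ₀, fun _ hC0 hC => not_endPossibleLin_bOct_of_lt_cStarConj hC0 hC hγ₀⟩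

/-- The threshold in the `sInf` form of GEN 10's `exists_threshold_bOct`: `sInf {C > 0 | EndPossibleLin bOct C γ₀} = cStarConj`. [folklore] -/
theorem sInf_possible_eq_cStarConj {γ₀ : ℝ} (hγ₀ : 0 < γ₀) : sInf {C : ℝ | 0 < C ∧ EndPossibleLin bOct C γ₀} = cStarConj := by
  set T : Set ℝ := {C : ℝ | 0 < C ∧ EndPossibleLin bOct C γ₀} with hT
  have hmem : ∀ C, cStarConj < C → C ∈ T := fun C hC =>
    ⟨lt_trans cStarConj_pos hC, endPossibleLin_bOct_of_gt_cStarConj hC hγ₀⟩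
  have hlow : ∀ C ∈ T, cStarConj ≤ C := fun C hC =>
    le_of_not_gt fun h => not_endPossibleLin_bOct_of_lt_cStarConj hC.1 h hγ₀ hC.2
  have hne : T.Nonempty := ⟨cStarConj + 1, hmem _ (by linarith)⟩
  refine le_antisymm ?_ (le_csInf hne hlow)
  exact le_of_forall_pos_le_add fun ε hε => csInf_le ⟨cStarConj, hlow⟩ (hmem _ (by linarith))

/-- **THE FULL TRICHOTOMY: for `0 < C` and every box `γ₀ > 0`, `EndPossibleLin bOct C γ₀ ↔ cStarConj < C`** — possible above the constant (this
file), impossible at and below it (X20 `not_endPossibleLin_bOct_of_le_cStarConj`, X18): the possible constants of the octal staircase on the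
linear road form exactly the OPEN half-line `(cStarConj, ∞)`, `cStarConj = √(84∕(77 + 72·log 2)) = 0.81357…`. [cite: Balaban1987RG1, Thm 2 p.259
(first sentence) and (2.12)–(2.14) p.268] -/
theorem endPossibleLin_bOct_iff {C γ₀ : ℝ} (hC : 0 < C) (hγ₀ : 0 < γ₀) : EndPossibleLin bOct C γ₀ ↔ cStarConj < C :=
  ⟨fun h => lt_of_not_ge fun hle => not_endPossibleLin_bOct_of_le_cStarConj hC hle hγ₀ h,
    fun h => endPossibleLin_bOct_of_gt_cStarConj h hγ₀⟩

/-- … and the set of possible positive constants IS the open half-line. [folklore] -/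
theorem possible_set_eq_Ioi {γ₀ : ℝ} (hγ₀ : 0 < γ₀) : {C : ℝ | 0 < C ∧ EndPossibleLin bOct C γ₀} = Set.Ioi cStarConj := by
  ext C
  simp only [Set.mem_setOf_eq, Set.mem_Ioi]
  constructor
  · rintro ⟨hC, h⟩; exact (endPossibleLin_bOct_iff hC hγ₀).mp h
  · intro h; exact ⟨lt_trans cStarConj_pos h, endPossibleLin_bOct_of_gt_cStarConj h hγ₀⟩

end

end Summit.QuantumFields.BalabanUV.Gaps.EndDrawdownLinearThresholdUpper
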